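import Literature.Topology.FourManifolds.OneHandleStepExists
import HarnessLib

/-!
# Discharge of Lickorish's F2b: `S³ = H ∪ᵢ H'` with `f⁻¹ ∘ i` orientation preserving

Topic `Literature/Topology/FourManifolds`; proofs-only leaf (no definition, no named fact) of the
Lickorish–Wallace DAG of `LickorishWallace.lean`. The named fact
`Literature.Topology.FourManifolds.IsHandlebody.exists_isBoundaryGluing_sphere` (F2b; Lickorish
1962, pp. 538–539: "There is a piecewise linear homeomorphism `i` such that `i : X₁ → X₂` and
`S³ = T₁ ∪_i T₂`. We can choose `i` so that `f⁻¹ i` is orientation preserving") was reduced in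
`LickorishWallaceLeaves.lean` to the single leaf L1 (`oneHandle_nonempty_diffeomorph`, uniqueness
of attaching one `1`-handle; `IsHandlebody.exists_isBoundaryGluing_sphere_of_oneHandle`, with the
genus-`g` splitting of `S³` (SPLIT) and the orientation-reversing symmetry of a handlebody (SYMM)
already theorems), and L1 is discharged in `OneHandleStepExists.lean`
(`oneHandle_nonempty_diffeomorph_holds`). Composing the two gives the discharge.

## References

* W. B. R. Lickorish, *A representation of orientable combinatorial 3-manifolds*, Ann. of Math.
  (2) 76 (1962), 531–540, pp. 538–539. [LickorishAnnals1962]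
* A. A. Kosinski, *Differential Manifolds* (1993), VI (6.4), (6.6), (7.1). [Kosinski1993]
-/

noncomputable section

namespace Literature.Topology.FourManifolds

universe u

/-- **Discharge of F2b** `Literature.Topology.FourManifolds.IsHandlebody.exists_isBoundaryGluing_sphere`
(Lickorish 1962, pp. 538–539): for genus-`g` handlebodies `H`, `H'` with boundary data `b`, `b'`
and any diffeomorphism `f : ∂H ≅ ∂H'` there are `i : ∂H ≅ ∂H'` with `S³ = H ∪ᵢ H'` and an
orientation of `∂H` for which `f⁻¹ ∘ i` is orientation preserving. The term is
`IsHandlebody.exists_isBoundaryGluing_sphere_of_oneHandle` (`LickorishWallaceLeaves.lean`) applied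
to the discharge `oneHandle_nonempty_diffeomorph_holds` of L1 (`OneHandleStepExists.lean`).
[cite: LickorishAnnals1962, pp. 538–539] -/
theorem IsHandlebody.exists_isBoundaryGluing_sphere_holds :
    IsHandlebody.exists_isBoundaryGluing_sphere.{u} :=
  IsHandlebody.exists_isBoundaryGluing_sphere_of_oneHandle oneHandle_nonempty_diffeomorph_holds

end Literature.Topology.FourManifolds

end
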